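import Summits.QuantumAdvantage.QuantumAdvantage.Theorems.CubicForrelationNearExactIsExactTwelveTypeO768PfTwist
import Summits.QuantumAdvantage.QuantumAdvantage.Theorems.CubicForrelationNearExactIsExactTwelveTypeOGe5964
import Summits.QuantumAdvantage.QuantumAdvantage.Theorems.CubicForrelationNearExactIsExactTwelveLevelSixEight

/-!
# Crux `CubicForrelation.NearExactIsExact` (stmt-QuantumAdvantage-14043) — n = 12, type O with `#E = 768`: `Φ ≤ 29/32`

Certificate seat `b2b-cforr-cert` (gen 15).  HONEST FRAMING: a kernel-checked lemma (standard axioms) about cubic Boolean pairs on 12 bits —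
one more brick under the open values `933/1024 … 943/1024` of `θ₁₂`: a TYPE-O side (`W_g = 16u`, some `u` odd) whose base-pattern set
`E = {[⌊u/2⌋ odd] = [⌊u/4⌋ odd]}` has exactly `768` points forces `Φ ≤ 29/32 = 928/1024`.  Together with `to15_typeO_E_ge_768`
(`Φ > 931/1024 ⇒ #E ≥ 768`) a type-O side above `931/1024` needs a cubic support `E` of size `> 768` (by Kasami–Tokura the next cubic
weight is `896`; that classification is NOT in the tree, so no overall type-O bound is claimed here).  NOT summit progress.

`to15_typeO_E768_le`.  Proof (wild-point parity along a twisted hyperplane).  Write `u − 4(−1)^f = τ₀ + 8v` with the base pattern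
`τ₀ = (−1)^{d₁}(1 − 4·[E]) = 2(−1)^{d₁ ⊕ c_E} − (−1)^{d₁}` (`d₁ = [⌊u/2⌋ odd]` affine, `c_E` the cubic indicator of `E`).  By
`to15_weight768_pf_twist` (weight-768 cubic supports lie in a hyperplane `A = {(−1)^{x·z} = t}`, and the quadratic `d₁ ⊕ c_E ⊕ c_E(·⊕w)`,
`w ∉ z^⊥`, has a 4-flat of `A` with Pfaffian `1`) there are `a₀,…,a₃ ∈ z^⊥` such that on EVERY 4-flat of `A` with these directions
`Σ (−1)^{d₁ ⊕ c_E} ≡ 4 (mod 8)` (`ws_sum4_mod8`, base-freeness `fr_hsd`), while on its `w`-translate (outside `A`, where `c_E = 0`) the sum is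
`≡ 0 (mod 16)` (Ax, degree 1).  Hence on every 5-flat `x ⊕ ⟨w, a₀, …, a₃⟩`: `Σ τ₀ ≡ 8 (mod 16)`, `Σ (u − 4(−1)^f) ≡ 0 (mod 16)` (flat sums of
`W_g/16` and Ax for `f`), so `Σ v` is odd and the flat carries a wild point (`v` odd, excess `≥ 16`).  These `4096/32 = 128` disjointly based wild
points cost `≥ 2048 > 2047 ≥ 2¹⁷(1 − Φ) − 10240` when `Φ > 29/32`.

References: Ax (1964); McEliece (1972); Kasami–Tokura (1970); MacWilliams–Sloane (1977) Ch. 15; Carlet (2021) §4.1, §5.  Axioms: standard.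
-/

set_option linter.dupNamespace false -- D-0017: single-problem summit ⇒ `QuantumAdvantage.QuantumAdvantage` by design

noncomputable section

namespace Summit.QuantumAdvantage.QuantumAdvantage.Theorems.CubicForrelation.NearExactIsExact

open Finset
open Literature.Computability.QuantumComplexity
open Literature.Computability.QuantumComplexity.BuzetChailloux (bxor zeroVec bxor_bxor_cancel_left bxor_zeroVec zeroVec_bxor bxor_comm
  bxor_self twist_zeroVec_right twist_bxor_right)
open Literature.Computability.QuantumComplexity.Simon (twist_eq_one_or)
open Literature.Computability.QuantumComplexity.DerivativeWalsh (W twist_bxor_left)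
open Summit.QuantumAdvantage.QuantumAdvantage.Theorems.NearExactIsExact.Negative (TypeOTwelve.typeO_of_exists_odd)

/-! ### Ax for affine functions on a parametrised flat -/

/-- **Ax on a parametrised `k`-flat for DEGREE 1**: `2^k ∣ Σ_ε (−1)^{D(b ⊕ a_ε)}` for affine `D` on 12 bits (pullback `fs_deg_pullback` +
`stub_axParity` with `d = 1`). [cite: Carlet2020, §4.1] -/
theorem to15_aff_flat_sum {k : ℕ} (D : (Fin (6 + 6) → Bool) → Bool) (hD : IsDegLeFun 1 D) (b : Fin (6 + 6) → Bool)
    (a : Fin k → Fin (6 + 6) → Bool) :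
    (2 : ℤ) ^ k ∣ ∑ ε : Fin k → Bool, sZ (D (fun j => b j ^^ decide (Odd #(univ.filter fun i => ε i && a i j)))) := by
  classical
  obtain ⟨z, hz⟩ := stub_axParity k 1 _ univ le_rfl (fs_deg_pullback D hD b a)
  rw [filter_true_of_mem (fun (u : Fin k → Bool) (_ : u ∈ univ) i (_ : u i = true) => mem_univ i), card_univ,
    Fintype.card_fin, show (k + 1 - 1) / 1 = k by omega] at hz
  refine ⟨z, ?_⟩
  have h : ((∑ ε : Fin k → Bool, sZ (D (fun j => b j ^^ decide (Odd #(univ.filter fun i => ε i && a i j)))) : ℤ) : ℝ) =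
      (((2 : ℤ) ^ k * z : ℤ) : ℝ) := by
    push_cast
    rw [sum_congr rfl fun ε _ => tp_sZ_cast _, hz]
  exact_mod_cast h

/-! ### The theorem -/

/-- **Type O with `#E = 768` forces `Φ ≤ 29/32` (12 bits).**  Cubic `f, g : 𝔽₂¹² → 𝔽₂` with `W_g = 16u`, some `u(x)` odd, and exactly
`768` points where `[⌊u/2⌋ odd] = [⌊u/4⌋ odd]`: then `Φ(f,g) ≤ 29/32`.  Wild-point parity along the twisted hyperplane supplied by
`to15_weight768_pf_twist`: every 5-flat `x ⊕ ⟨w, a₀, …, a₃⟩` carries a wild point, `128` of them cost `2048 > 2¹⁷(1 − Φ) − 10240`.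
Finite-slice statement; NOT summit progress. [this work] -/
theorem to15_typeO_E768_le (f g : (Fin (6 + 6) → Bool) → Bool) (hf : IsDegLeFun 3 f) (hg : IsDegLeFun 3 g)
    (u : (Fin (6 + 6) → Bool) → ℤ) (hu : ∀ x, W (fun y => signOf (g y)) x = (2 : ℝ) ^ 4 * (u x : ℝ))
    (hodd : ∃ x, Odd (u x)) (hE : #(univ.filter fun x : Fin (6 + 6) → Bool => (Odd (u x / 2) ↔ Odd (u x / 2 / 2))) = 768) :
    forrelation f g ≤ 29 / 32 := by
  classical
  by_contra hΦ
  push Not at hΦ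
  have hall : ∀ x, Odd (u x) := TypeOTwelve.typeO_of_exists_odd g u hg hu hodd
  have hu' : ∀ x, W (fun y => signOf (g y)) x = (2 : ℝ) ^ (2 * 2) * (u x : ℝ) := fun x => (hu x).trans (by norm_num)
  -- opaque names for the affine digit `d₁` and the cubic indicator `cE` of `E`
  obtain ⟨d₁, hd₁⟩ : ∃ d₁ : (Fin (6 + 6) → Bool) → Bool, d₁ = fun x => decide (Odd (u x / 2)) := ⟨_, rfl⟩
  obtain ⟨cE, hcE⟩ : ∃ cE : (Fin (6 + 6) → Bool) → Bool,
      cE = fun x => (decide (Odd (u x / 2)) ^^ decide (Odd (u x / 2 / 2))) ^^ true := ⟨_, rfl⟩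
  have hd1 : IsDegLeFun 1 d₁ := by rw [hd₁]; exact z2_digitOne 2 g u hg hu' hall
  have hcE3 : IsDegLeFun 3 cE := by
    rw [hcE]
    exact tb_isDegLeFun_xor_const (bb_isDegLeFun_bxor ((z2_digitOne 2 g u hg hu' hall).mono (by norm_num))
      (z2_digitTwo 2 g u hg hu' hall)) true
  have hd₁x : ∀ x, d₁ x = decide (Odd (u x / 2)) := fun x => by rw [hd₁]
  have hcEx : ∀ x, cE x = decide (Odd (u x / 2) ↔ Odd (u x / 2 / 2)) := by
    intro x
    rw [hcE]
    by_cases h1 : Odd (u x / 2) <;> by_cases h2 : Odd (u x / 2 / 2) <;> simp [h1, h2]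
  have hcE768 : #(univ.filter fun x => cE x = true) = 768 := by
    have e : (univ.filter fun x : Fin (6 + 6) → Bool => cE x = true) =
        univ.filter (fun x => (Odd (u x / 2) ↔ Odd (u x / 2 / 2))) :=
      filter_congr fun x _ => by rw [hcEx x, decide_eq_true_iff]
    rw [e]
    exact hE
  -- budget `Σ (u − 4(−1)^f)² = 2¹⁷(1 − Φ) ≤ 12287`
  have hbud := tw12_budget f g u hu
  have hT : (∑ x, (u x - 4 * sZ (f x)) ^ 2 : ℤ) ≤ 12287 := by
    have h' : ((∑ x, (u x - 4 * sZ (f x)) ^ 2 : ℤ) : ℝ) < 12288 := by rw [hbud]; linarith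
    have h'' : (∑ x, (u x - 4 * sZ (f x)) ^ 2 : ℤ) < 12288 := by exact_mod_cast h'
    omega
  -- base pattern `τ₀` and wild function `v`: `u − 4(−1)^f = τ₀ + 8v`
  choose v hv using fun x => to12_pt_mod8 (u x) (sZ (f x)) (hall x) (tp_sZ_cases (f x))
  set τ₀ : (Fin (6 + 6) → Bool) → ℤ := fun x =>
    sZ (decide (Odd (u x / 2))) * (1 - 4 * (if (Odd (u x / 2) ↔ Odd (u x / 2 / 2)) then 1 else 0)) with hτ₀def
  have hvx : ∀ x, u x - 4 * sZ (f x) = τ₀ x + 8 * v x := fun x => hv x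
  have hτ₀val : ∀ x, τ₀ x = 1 ∨ τ₀ x = -1 ∨ τ₀ x = 3 ∨ τ₀ x = -3 := by
    intro x
    simp only [τ₀]
    rcases tp_sZ_cases (decide (Odd (u x / 2))) with h | h <;> rw [h] <;> split_ifs <;> norm_num
  have hτ₀sq : ∀ x, τ₀ x ^ 2 = 1 + 8 * (if (Odd (u x / 2) ↔ Odd (u x / 2 / 2)) then 1 else 0 : ℤ) := by
    intro x
    simp only [τ₀]
    rcases tp_sZ_cases (decide (Odd (u x / 2))) with h | h <;> rw [h] <;> split_ifs <;> norm_num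
  have hsumE : (∑ x, (if (Odd (u x / 2) ↔ Odd (u x / 2 / 2)) then 1 else 0 : ℤ)) = 768 := by
    rw [sum_boole]
    exact_mod_cast hE
  have hsumτ₀ : ∑ x, τ₀ x ^ 2 = 10240 := by
    rw [sum_congr rfl fun x _ => hτ₀sq x, sum_add_distrib, ← mul_sum, hsumE, sum_const, card_univ, Fintype.card_fun,
      Fintype.card_bool, Fintype.card_fin]
    norm_num
  have hτ₀alt : ∀ x, τ₀ x = 2 * sZ (d₁ x ^^ cE x) - sZ (d₁ x) := by
    intro x
    simp only [τ₀]
    rw [hd₁x x, hcEx x]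
    by_cases h1 : Odd (u x / 2) <;> by_cases h2 : Odd (u x / 2 / 2) <;> simp [h1, h2, sZ]
  -- excess decomposition `Σ τ² = Σ τ₀² + Σ X`, `X ≥ 0`, `Σ X ≤ 2047`
  set X : (Fin (6 + 6) → Bool) → ℤ := fun x => (τ₀ x + 8 * v x) ^ 2 - τ₀ x ^ 2 with hXdef
  have hXnn : ∀ x, 0 ≤ X x := fun x => to12_excess_nonneg _ _ (hτ₀val x)
  have hTdec : (∑ x, (u x - 4 * sZ (f x)) ^ 2 : ℤ) = ∑ x, τ₀ x ^ 2 + ∑ x, X x := by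
    rw [← sum_add_distrib]
    exact sum_congr rfl fun x _ => by rw [hvx x]; simp only [X]; ring
  have hXsum : ∑ x, X x ≤ 2047 := by rw [hTdec, hsumτ₀] at hT; linarith
  -- the twisted hyperplane witness
  obtain ⟨z, w, t, _, ht, hEA, hw, x₀, a₀, a₁, a₂, a₃, hx₀, ha₀, ha₁, ha₂, ha₃, hwit⟩ :=
    to15_weight768_pf_twist cE hcE3 hcE768 d₁ hd1
  set A := univ.filter (fun x : Fin (6 + 6) → Bool => twist x z = t) with hAdef
  have hmemA : ∀ x, x ∈ A ↔ twist x z = t := fun x => by simp [hAdef]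
  have hmemA' : ∀ x, x ∈ A ↔ twist z x = t := fun x => by rw [hmemA, twist_comm]
  set V₀ := univ.filter (fun a : Fin (6 + 6) → Bool => twist z a = 1) with hV₀def
  have hVmem : ∀ a, a ∈ V₀ ↔ twist z a = 1 := fun a => by rw [hV₀def, mem_filter]; simp
  have hV0 : zeroVec ∈ V₀ := (hVmem _).2 (twist_zeroVec_right z)
  have hVadd : ∀ x ∈ V₀, ∀ y ∈ V₀, bxor x y ∈ V₀ := by
    intro x hx y hy; rw [hVmem] at hx hy ⊢; rw [twist_bxor_right, hx, hy, mul_one]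
  have hx₀A : x₀ ∈ A := (hmemA x₀).2 hx₀
  have hS_A : A = V₀.image (bxor x₀) := tw59_eq_image A V₀ z t hmemA' hVmem x₀ hx₀A
  have hPV : ∀ x, x ∈ A → ∀ a ∈ V₀, bxor x a ∈ A := fun x hx a ha => fl1_coset_vadd hVadd hS_A hx ha
  have hVP : ∀ x, x ∈ A → bxor x₀ x ∈ V₀ := by
    intro x hx
    rw [hVmem, twist_bxor_right, (hmemA' x₀).1 hx₀A, (hmemA' x).1 hx]
    rcases ht with rfl | rfl <;> norm_num
  have ha₀V : a₀ ∈ V₀ := (hVmem _).2 ha₀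
  have ha₁V : a₁ ∈ V₀ := (hVmem _).2 ha₁
  have ha₂V : a₂ ∈ V₀ := (hVmem _).2 ha₂
  have ha₃V : a₃ ∈ V₀ := (hVmem _).2 ha₃
  have haV : ∀ i, (![a₀, a₁, a₂, a₃] : Fin 4 → Fin (6 + 6) → Bool) i ∈ V₀ := fun i => by
    fin_cases i <;> assumption
  -- `cE = 0` off `A`; translating by `w` swaps `A` and its complement
  have hout : ∀ x, x ∉ A → cE x = false := by
    intro x hx
    by_contra h
    rw [Bool.not_eq_false] at h
    exact hx ((hmemA x).2 (hEA x h))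
  have hwA : ∀ x, x ∈ A → bxor x w ∉ A := by
    intro x hx h
    have h1 := (hmemA _).1 h
    rw [twist_bxor_left, (hmemA x).1 hx, hw] at h1
    rcases ht with rfl | rfl <;> norm_num at h1
  have hwA' : ∀ x, x ∉ A → bxor x w ∈ A := by
    intro x hx
    rw [hmemA] at hx ⊢
    rw [twist_bxor_left, hw]
    rcases ht with rfl | rfl
    · rcases twist_eq_one_or x z with h | h
      · exact absurd h hx
      · rw [h]; norm_num
    · rcases twist_eq_one_or x z with h | h
      · rw [h]; norm_num
      · exact absurd h hx
  have hcancel : ∀ x : Fin (6 + 6) → Bool, bxor (bxor x w) w = x := fun x => by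
    rw [iw_bxor_assoc, bxor_self, bxor_zeroVec]
  -- flat points: membership in `A`, and translation by `w`
  have hA4 : ∀ x, x ∈ A → ∀ ε : Fin 4 → Bool, (fun j => x j ^^ decide (Odd #(univ.filter fun i =>
      ε i && (![a₀, a₁, a₂, a₃] : Fin 4 → Fin (6 + 6) → Bool) i j))) ∈ A :=
    fun x hx ε => fr_mem_flatPt4 V₀ hV0 (· ∈ A) hPV hx _ haV ε
  have hflip : ∀ (x : Fin (6 + 6) → Bool) (ε : Fin 4 → Bool),
      bxor (fun j => x j ^^ decide (Odd #(univ.filter fun i => ε i && (![a₀, a₁, a₂, a₃] : Fin 4 → Fin (6 + 6) → Bool) i j))) w =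
        (fun j => (bxor x w) j ^^ decide (Odd #(univ.filter fun i =>
          ε i && (![a₀, a₁, a₂, a₃] : Fin 4 → Fin (6 + 6) → Bool) i j))) := by
    intro x ε
    funext j
    simp only [bxor]
    cases x j <;> cases w j <;> simp
  have hnotA4 : ∀ x, x ∉ A → ∀ ε : Fin 4 → Bool, (fun j => x j ^^ decide (Odd #(univ.filter fun i =>
      ε i && (![a₀, a₁, a₂, a₃] : Fin 4 → Fin (6 + 6) → Bool) i j))) ∉ A := by
    intro x hx ε hmem
    have h := hwA _ (hA4 _ (hwA' x hx) ε)
    rw [hflip (bxor x w) ε, hcancel x] at h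
    exact h hmem
  -- the quadratic `hB = d₁ ⊕ cE ⊕ cE(·⊕w)`: base-free symplectic defects on `A`, Pfaffian `1`
  obtain ⟨hB, hhB⟩ : ∃ hB : (Fin (6 + 6) → Bool) → Bool, hB = fun x => d₁ x ^^ (cE x ^^ cE (bxor x w)) := ⟨_, rfl⟩
  have hBx : ∀ y, hB y = (d₁ y ^^ (cE y ^^ cE (bxor y w))) := fun y => by rw [hhB]
  have hhB2 : IsDegLeFun 2 hB := by
    rw [hhB]
    exact bb_isDegLeFun_bxor (hd1.mono (by norm_num)) (stub_derivDegree (6 + 6) 2 cE w hcE3)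
  have H3 : ∀ x, x ∈ A → ∀ a b e : Fin (6 + 6) → Bool, a ∈ V₀ → b ∈ V₀ → e ∈ V₀ →
      (4 : ℤ) ∣ ∑ ε : Fin 3 → Bool, sZ (hB (fun j => x j ^^ decide (Odd #(univ.filter fun i =>
        ε i && (![a, b, e] : Fin 3 → Fin (6 + 6) → Bool) i j)))) := by
    intro x _ a b e _ _ _
    have h := tw15_quad_flat_sum hB hhB2 x ![a, b, e]
    rw [show (2 : ℤ) ^ ((3 + 1) / 2) = 4 by norm_num] at h
    exact h
  have hsd := fr_hsd V₀ (· ∈ A) x₀ hx₀A hVP hB H3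
  have hwit' : ¬ (8 : ℤ) ∣ ∑ ε : Fin 4 → Bool, sZ (hB (fun j => x₀ j ^^ decide (Odd #(univ.filter fun i =>
      ε i && (![a₀, a₁, a₂, a₃] : Fin 4 → Fin (6 + 6) → Bool) i j)))) := by
    simpa only [hBx] using hwit
  have key : ∀ x, x ∈ A → (∑ ε : Fin 4 → Bool, sZ (hB (fun j => x j ^^ decide (Odd #(univ.filter fun i =>
      ε i && (![a₀, a₁, a₂, a₃] : Fin 4 → Fin (6 + 6) → Bool) i j))))) % 8 = 4 := by
    intro x hx
    have hm := ws_sum4_mod8 V₀ (· ∈ A) x₀ hB hPV hsd hx ha₀V ha₁V ha₂V ha₃V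
    have hm₀ := ws_sum4_mod8 V₀ (· ∈ A) x₀ hB hPV hsd hx₀A ha₀V ha₁V ha₂V ha₃V
    split_ifs at hm hm₀ with hP
    · exact hm
    · exact absurd (Int.dvd_of_emod_eq_zero hm₀) hwit'
  -- on every 5-flat `x ⊕ ⟨w, a₀, …, a₃⟩`: `Σ (−1)^{d₁ ⊕ cE} ≡ 4 (mod 8)`
  have hpeel : ∀ x : Fin (6 + 6) → Bool,
      ∑ ε : Fin (4 + 1) → Bool, sZ (d₁ (fun j => x j ^^ decide (Odd #(univ.filter fun i =>
          ε i && (Matrix.vecCons w ![a₀, a₁, a₂, a₃] : Fin (4 + 1) → Fin (6 + 6) → Bool) i j))) ^^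
        cE (fun j => x j ^^ decide (Odd #(univ.filter fun i =>
          ε i && (Matrix.vecCons w ![a₀, a₁, a₂, a₃] : Fin (4 + 1) → Fin (6 + 6) → Bool) i j)))) =
      ∑ ε : Fin 4 → Bool, sZ (d₁ (fun j => x j ^^ decide (Odd #(univ.filter fun i =>
          ε i && (![a₀, a₁, a₂, a₃] : Fin 4 → Fin (6 + 6) → Bool) i j))) ^^
        cE (fun j => x j ^^ decide (Odd #(univ.filter fun i =>
          ε i && (![a₀, a₁, a₂, a₃] : Fin 4 → Fin (6 + 6) → Bool) i j)))) +
      ∑ ε : Fin 4 → Bool, sZ (d₁ (bxor (fun j => x j ^^ decide (Odd #(univ.filter fun i =>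
          ε i && (![a₀, a₁, a₂, a₃] : Fin 4 → Fin (6 + 6) → Bool) i j))) w) ^^
        cE (bxor (fun j => x j ^^ decide (Odd #(univ.filter fun i =>
          ε i && (![a₀, a₁, a₂, a₃] : Fin 4 → Fin (6 + 6) → Bool) i j))) w)) := by
    intro x
    have e := fr_sum_peel (k := 4) (fun y => sZ (d₁ y ^^ cE y)) x w ![a₀, a₁, a₂, a₃]
    beta_reduce at e
    exact e
  have hmod4 : ∀ x : Fin (6 + 6) → Bool,
      (∑ ε : Fin (4 + 1) → Bool, sZ (d₁ (fun j => x j ^^ decide (Odd #(univ.filter fun i =>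
          ε i && (Matrix.vecCons w ![a₀, a₁, a₂, a₃] : Fin (4 + 1) → Fin (6 + 6) → Bool) i j))) ^^
        cE (fun j => x j ^^ decide (Odd #(univ.filter fun i =>
          ε i && (Matrix.vecCons w ![a₀, a₁, a₂, a₃] : Fin (4 + 1) → Fin (6 + 6) → Bool) i j))))) % 8 = 4 := by
    intro x
    rw [hpeel x]
    by_cases hxA : x ∈ A
    · have h1 : ∑ ε : Fin 4 → Bool, sZ (d₁ (fun j => x j ^^ decide (Odd #(univ.filter fun i =>
            ε i && (![a₀, a₁, a₂, a₃] : Fin 4 → Fin (6 + 6) → Bool) i j))) ^^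
          cE (fun j => x j ^^ decide (Odd #(univ.filter fun i =>
            ε i && (![a₀, a₁, a₂, a₃] : Fin 4 → Fin (6 + 6) → Bool) i j)))) =
          ∑ ε : Fin 4 → Bool, sZ (hB (fun j => x j ^^ decide (Odd #(univ.filter fun i =>
            ε i && (![a₀, a₁, a₂, a₃] : Fin 4 → Fin (6 + 6) → Bool) i j)))) :=
        sum_congr rfl fun ε _ => by rw [hBx, hout _ (hwA _ (hA4 x hxA ε)), Bool.xor_false]
      have h2 : ∑ ε : Fin 4 → Bool, sZ (d₁ (bxor (fun j => x j ^^ decide (Odd #(univ.filter fun i =>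
            ε i && (![a₀, a₁, a₂, a₃] : Fin 4 → Fin (6 + 6) → Bool) i j))) w) ^^
          cE (bxor (fun j => x j ^^ decide (Odd #(univ.filter fun i =>
            ε i && (![a₀, a₁, a₂, a₃] : Fin 4 → Fin (6 + 6) → Bool) i j))) w)) =
          ∑ ε : Fin 4 → Bool, sZ (d₁ (fun j => (bxor x w) j ^^ decide (Odd #(univ.filter fun i =>
            ε i && (![a₀, a₁, a₂, a₃] : Fin 4 → Fin (6 + 6) → Bool) i j)))) :=
        sum_congr rfl fun ε _ => by rw [hout _ (hwA _ (hA4 x hxA ε)), Bool.xor_false, hflip x ε]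
      have h3 : (16 : ℤ) ∣ ∑ ε : Fin 4 → Bool, sZ (d₁ (fun j => (bxor x w) j ^^ decide (Odd #(univ.filter fun i =>
            ε i && (![a₀, a₁, a₂, a₃] : Fin 4 → Fin (6 + 6) → Bool) i j)))) := by
        have h := to15_aff_flat_sum (k := 4) d₁ hd1 (bxor x w) (![a₀, a₁, a₂, a₃] : Fin 4 → Fin (6 + 6) → Bool)
        rw [show (2 : ℤ) ^ 4 = 16 by norm_num] at h
        exact h
      rw [h1, h2]
      have hk := key x hxA
      omega
    · have h1 : ∑ ε : Fin 4 → Bool, sZ (d₁ (fun j => x j ^^ decide (Odd #(univ.filter fun i =>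
            ε i && (![a₀, a₁, a₂, a₃] : Fin 4 → Fin (6 + 6) → Bool) i j))) ^^
          cE (fun j => x j ^^ decide (Odd #(univ.filter fun i =>
            ε i && (![a₀, a₁, a₂, a₃] : Fin 4 → Fin (6 + 6) → Bool) i j)))) =
          ∑ ε : Fin 4 → Bool, sZ (d₁ (fun j => x j ^^ decide (Odd #(univ.filter fun i =>
            ε i && (![a₀, a₁, a₂, a₃] : Fin 4 → Fin (6 + 6) → Bool) i j)))) :=
        sum_congr rfl fun ε _ => by rw [hout _ (hnotA4 x hxA ε), Bool.xor_false]
      have h2 : ∑ ε : Fin 4 → Bool, sZ (d₁ (bxor (fun j => x j ^^ decide (Odd #(univ.filter fun i =>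
            ε i && (![a₀, a₁, a₂, a₃] : Fin 4 → Fin (6 + 6) → Bool) i j))) w) ^^
          cE (bxor (fun j => x j ^^ decide (Odd #(univ.filter fun i =>
            ε i && (![a₀, a₁, a₂, a₃] : Fin 4 → Fin (6 + 6) → Bool) i j))) w)) =
          ∑ ε : Fin 4 → Bool, sZ (hB (fun j => (bxor x w) j ^^ decide (Odd #(univ.filter fun i =>
            ε i && (![a₀, a₁, a₂, a₃] : Fin 4 → Fin (6 + 6) → Bool) i j)))) :=
        sum_congr rfl fun ε _ => by
          rw [hflip x ε, hBx, hout _ (hwA _ (hA4 _ (hwA' x hxA) ε)), Bool.xor_false]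
      have h3 : (16 : ℤ) ∣ ∑ ε : Fin 4 → Bool, sZ (d₁ (fun j => x j ^^ decide (Odd #(univ.filter fun i =>
            ε i && (![a₀, a₁, a₂, a₃] : Fin 4 → Fin (6 + 6) → Bool) i j)))) := by
        have h := to15_aff_flat_sum (k := 4) d₁ hd1 x (![a₀, a₁, a₂, a₃] : Fin 4 → Fin (6 + 6) → Bool)
        rw [show (2 : ℤ) ^ 4 = 16 by norm_num] at h
        exact h
      rw [h1, h2]
      have hk := key (bxor x w) (hwA' x hxA)
      omega
  -- flat sums of `u − 4(−1)^f` (`≡ 0 mod 16`) and of `(−1)^{d₁}` (`≡ 0 mod 32`) on the 5-flats ⇒ `Σ v` odd ⇒ a wild point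
  have h16τ : ∀ x : Fin (6 + 6) → Bool, (16 : ℤ) ∣ ∑ ε : Fin (4 + 1) → Bool,
      (u (fun j => x j ^^ decide (Odd #(univ.filter fun i =>
          ε i && (Matrix.vecCons w ![a₀, a₁, a₂, a₃] : Fin (4 + 1) → Fin (6 + 6) → Bool) i j))) -
        4 * sZ (f (fun j => x j ^^ decide (Odd #(univ.filter fun i =>
          ε i && (Matrix.vecCons w ![a₀, a₁, a₂, a₃] : Fin (4 + 1) → Fin (6 + 6) → Bool) i j))))) := by
    intro x
    have hU := fs_flat_sum_dvd (k := 4 + 1) (j := 4) (e := 4) g u hg hu x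
      (Matrix.vecCons w ![a₀, a₁, a₂, a₃] : Fin (4 + 1) → Fin (6 + 6) → Bool) (by norm_num)
    obtain ⟨zf, hzf⟩ := sl_sum_sZ_flat (k := 4 + 1) f hf x (Matrix.vecCons w ![a₀, a₁, a₂, a₃] : Fin (4 + 1) → Fin (6 + 6) → Bool)
    rw [show (2 : ℤ) ^ 4 = 16 by norm_num] at hU
    rw [show ((4 + 1 + 2) / 3 : ℕ) = 2 by norm_num] at hzf
    rw [sum_sub_distrib, ← mul_sum, hzf]
    exact dvd_sub hU ⟨zf, by ring⟩
  have hoddpt : ∀ x : Fin (6 + 6) → Bool, ∃ ε : Fin (4 + 1) → Bool,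
      Odd (v (fun j => x j ^^ decide (Odd #(univ.filter fun i =>
        ε i && (Matrix.vecCons w ![a₀, a₁, a₂, a₃] : Fin (4 + 1) → Fin (6 + 6) → Bool) i j)))) := by
    intro x
    have hT5 := h16τ x
    have hD5 : (32 : ℤ) ∣ ∑ ε : Fin (4 + 1) → Bool, sZ (d₁ (fun j => x j ^^ decide (Odd #(univ.filter fun i =>
        ε i && (Matrix.vecCons w ![a₀, a₁, a₂, a₃] : Fin (4 + 1) → Fin (6 + 6) → Bool) i j)))) := by
      have h := to15_aff_flat_sum (k := 4 + 1) d₁ hd1 x (Matrix.vecCons w ![a₀, a₁, a₂, a₃] : Fin (4 + 1) → Fin (6 + 6) → Bool)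
      rw [show (2 : ℤ) ^ (4 + 1) = 32 by norm_num] at h
      exact h
    have hF5 := hmod4 x
    rw [sum_congr rfl fun ε _ => hvx _, sum_add_distrib, sum_congr rfl fun ε _ => hτ₀alt _, sum_sub_distrib, ← mul_sum,
      ← mul_sum] at hT5
    by_contra hne
    push Not at hne
    have h2 : (2 : ℤ) ∣ ∑ ε : Fin (4 + 1) → Bool, v (fun j => x j ^^ decide (Odd #(univ.filter fun i =>
        ε i && (Matrix.vecCons w ![a₀, a₁, a₂, a₃] : Fin (4 + 1) → Fin (6 + 6) → Bool) i j))) :=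
      dvd_sum fun ε _ => even_iff_two_dvd.1 (Int.not_odd_iff_even.1 (hne ε))
    omega
  -- covering: every point is `(wild point) ⊕ (span point)`, so `#{v odd} · 32 ≥ 4096`
  set O := univ.filter (fun y : Fin (6 + 6) → Bool => Odd (v y)) with hOdef
  set Dset := (univ : Finset (Fin (4 + 1) → Bool)).image (fun ε => (fun j => (zeroVec : Fin (6 + 6) → Bool) j ^^
      decide (Odd #(univ.filter fun i => ε i && (Matrix.vecCons w ![a₀, a₁, a₂, a₃] : Fin (4 + 1) → Fin (6 + 6) → Bool) i j))))
    with hDdef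
  have hDcard : #Dset ≤ 32 := by
    refine card_image_le.trans ?_
    rw [card_univ, Fintype.card_fun, Fintype.card_bool, Fintype.card_fin]
    norm_num
  have hcover : (univ : Finset (Fin (6 + 6) → Bool)) ⊆ (O ×ˢ Dset).image (fun q => bxor q.1 q.2) := by
    intro x _
    obtain ⟨ε, hε⟩ := hoddpt x
    rw [mem_image]
    refine ⟨((fun j => x j ^^ decide (Odd #(univ.filter fun i =>
        ε i && (Matrix.vecCons w ![a₀, a₁, a₂, a₃] : Fin (4 + 1) → Fin (6 + 6) → Bool) i j))),
      (fun j => (zeroVec : Fin (6 + 6) → Bool) j ^^ decide (Odd #(univ.filter fun i =>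
        ε i && (Matrix.vecCons w ![a₀, a₁, a₂, a₃] : Fin (4 + 1) → Fin (6 + 6) → Bool) i j)))),
      mem_product.2 ⟨by rw [hOdef, mem_filter]; exact ⟨mem_univ _, hε⟩, mem_image_of_mem _ (mem_univ ε)⟩, ?_⟩
    show bxor (fun j => x j ^^ decide (Odd #(univ.filter fun i =>
        ε i && (Matrix.vecCons w ![a₀, a₁, a₂, a₃] : Fin (4 + 1) → Fin (6 + 6) → Bool) i j)))
      (fun j => (zeroVec : Fin (6 + 6) → Bool) j ^^ decide (Odd #(univ.filter fun i =>
        ε i && (Matrix.vecCons w ![a₀, a₁, a₂, a₃] : Fin (4 + 1) → Fin (6 + 6) → Bool) i j))) = x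
    rw [ws_flatPt_eq_bxor x _ ε, iw_bxor_assoc, bxor_self, bxor_zeroVec]
  have hcount : 4096 ≤ #O * 32 :=
    calc 4096 = #(univ : Finset (Fin (6 + 6) → Bool)) := by
            rw [card_univ, Fintype.card_fun, Fintype.card_bool, Fintype.card_fin]; norm_num
      _ ≤ #((O ×ˢ Dset).image (fun q => bxor q.1 q.2)) := card_le_card hcover
      _ ≤ #(O ×ˢ Dset) := card_image_le
      _ = #O * #Dset := card_product _ _
      _ ≤ #O * 32 := Nat.mul_le_mul_left _ hDcard
  -- each wild point costs `≥ 16`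
  have hOX : (16 : ℤ) * #O ≤ ∑ x, X x :=
    calc (16 : ℤ) * #O = ∑ x ∈ O, (16 : ℤ) := by rw [sum_const, nsmul_eq_mul]; ring
      _ ≤ ∑ x ∈ O, X x := sum_le_sum fun x hx => by
          have hvodd : Odd (v x) := (mem_filter.1 hx).2
          have h1 : 1 ≤ v x ∨ v x ≤ -1 := by have := Int.odd_iff.1 hvodd; omega
          have h := to12_excess _ _ 1 (hτ₀val x) le_rfl h1
          simp only [X]
          linarith
      _ ≤ ∑ x, X x := sum_le_sum_of_subset_of_nonneg (subset_univ _) fun x _ _ => hXnn x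
  have hc' : (4096 : ℤ) ≤ (#O : ℤ) * 32 := by exact_mod_cast hcount
  linarith

end Summit.QuantumAdvantage.QuantumAdvantage.Theorems.CubicForrelation.NearExactIsExact

end
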